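import Summits.BirchSwinnertonDyer.BirchSwinnertonDyer.Theorems.SignedLowerHalvesKobayashiLowerHalfSemistableIndexTransfer

/-!
# Route `SignedLowerHalves`, crux `KobayashiLowerHalfSemistable` (item stmt-BirchSwinnertonDyer-19000): the SPLIT
# BIT, part A — the Hecke action on the four lattices `L_ε` of bstw-MEMO-10 §4; (♭′-1) the Manin–Drinfeld-type
# extension splits iff `ε = (0,0)`; (♭′-3) the action mod `X` is scalar iff `ε = (0,0)`, non-semisimple otherwise
# (cell `bsd-ssimc`, seat `bsd-ssimc-k3-c2` gen 11, object «SPLIT-BIT», planner ruling D22-4;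
# a `--supports stmt-BirchSwinnertonDyer-19000 --as helper` file: closes nothing)

PARTITION (cell bsd-ssimc): X6 ∧ r = 0 (A6) × the 12 cells at `p = 3` + X6 r1 @ 3 + D2 literal @ 3 —
types-the-object-of (the commutative algebra inside the WORDING OF RECORD of the `p = 3` residual of
Burungale–Skinner–Tian–Wan, arXiv:2409.01350 (BSTW), Part I Thm. 1.3 on semistable curves, TARGET l.2 (b): "the
Λ-adic Manin–Drinfeld extension … does NOT split as a module over the completed Hecke algebra (⟺ ℍ̃ ≠ 𝕋̃ ⟺ the
weight-one Hecke algebra acts non-semisimply)"); closes NONE; nothing booked. HONEST FRAMING: pure commutative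
algebra (linear algebra over a commutative ring, Mathlib notions only, sorry-free). THE MODEL IS bstw-MEMO-10
§3–§4's RANK-3 LATTICE MODEL, NOT the Λ-adic Hecke modules themselves: NOT (3-ii)♭′, NOT B1, NOT the located
bookkeeping (m1)–(m4), NOT a binder, NO tier change; crux 2 kernel state p441716
(`KobayashiLowerHalfSemistable_of_tiersS_S3`) unchanged; nothing about modular curves, Hida families or elliptic
curves is asserted; BSD is not proved by any of this.

Source: `run/shared/lean/pub/bsd-ssimc/bstw-MEMO-10.md` (sha16 56db55b328bab2c5) §4 ((C4): the lattices `L_ε`,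
"𝓡-stability", the three equivalent phrasings (♭′-1)/(♭′-2)/(♭′-3)). This file EXTENDS gen 10's
`SignedLowerHalvesKobayashiLowerHalfSemistableIndexTransfer.lean` (p456967, namespace `…Theorems.IndexTransfer`);
ONE SYMBOL DICTIONARY across both files — p456967's entries verbatim: `Λ = Λ_L^v` (§3) resp. `ℚ̄_p⟦X⟧` (§4) ↔ `R`,
any commutative ring (a domain where stated) · `T_v` ↔ `t`, `X` ↔ `X` · `L_ε = ⟨h, ẽ₁, ẽ₂⟩` ↔ `R × R × R` with
`h = (1,0,0)`, `ẽ₁ = (0,1,0)`, `ẽ₂ = (0,0,1)` · `ε = (ε₁, ε₂) ∈ {0,1}²` ↔ `ε₁ ε₂ : R` with `ε_i = 0 ∨ ε_i = 1`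
· `𝔞L_ε` (`𝔞 = ker λ_{𝐡_v}`) ↔ `N` · `φ_ε` ↔ `φ` with `hφ : φ (x₀,x₁,x₂) = X x₀ − ε₁ x₁ − ε₂ x₂` · `F_ε` ↔
`((R × R × R) ⧸ N) ⧸ torsion`. NEW entries (this file): a Hecke element `t ∈ 𝓡` (the completed Hecke algebra
at the weight-one Eisenstein point) ↔ the triple of its eigenvalues `(λ_{𝐡_v}(t), λ_{𝐄₁}(t), λ_{𝐄₂}(t)) =
(a, a + X d₁, a + X d₂)` — memo (m3): the congruence ideals `𝔡_i = (λ_{𝐄_i} − λ_{𝐡_v})(𝓡)` equal `(X)`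
(Betina–Dimitrov–Pozzi), so `d_i ∈ R` and SOME `t` has `d_i` a unit ↔ `(a, d₁, d₂)` · the action of `t` on
`L_ε` (memo §4: "`t·h = λ₀(t)h`, `t·ẽ_i = λ_i(t)ẽ_i + ε_i((λ_i − λ₀)(t)/X)·h`") ↔ the operator family `T` with
`hT : T a d₁ d₂ (x₀,x₁,x₂) = (a x₀ + ε₁d₁x₁ + ε₂d₂x₂, (a + X d₁)x₁, (a + X d₂)x₂)` · the cusp module
`C_{Q₀} = L_ε / ℚ̄_p⟦X⟧h` with its diagonal action `(λ_{𝐄₁}, λ_{𝐄₂})` (memo (m1)) ↔ `R × R` with the family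
`Tb`, `hTb : Tb a d₁ d₂ (y₁,y₂) = ((a + X d₁)y₁, (a + X d₂)y₂)`, the projection being `LinearMap.snd R R (R × R)`
· `L_ε / X L_ε` (the weight-one fibre) ↔ `(R × R × R) ⧸ (X • ⊤)`.

WHAT IS KERNEL-CHECKED (part A). (i) ACTION: the families `T`, `Tb` exist, compose by the fibre-product law
(`comp_eq`), `T_t = λ₀(t) + T_{(0,d₁,d₂)}`, `h` is a common eigenvector (`apply_h`: the cuspidal line is an
`𝓡`-submodule, memo (m4)), the projection to `C` is equivariant (`snd_comp`). (ii) **(♭′-1) SPLITTING**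
(`exists_equivariant_section_iff`): for `X` a NON-UNIT and `ε_i ∈ {0,1}`, `0 → Rh → L_ε → C → 0` has a
`T`-equivariant `R`-linear section IFF `ε = (0,0)`; robustly ((m3) only), equivariance for ONE `t` with `d_i` a
unit forces `ε_i = 0` (`eps₁_eq_zero_of_comm`, `eps₂_eq_zero_of_comm`). (iii) **(♭′-3) mod `X`**
(`forall_sub_smul_mem_iff`): for `X` a NON-UNIT and `ε_i ∈ {0,1}`, EVERY `T_t` is the scalar `λ̄(t)` on `L_ε/XL_ε`
IFF `ε = (0,0)`; for `ε₁ = 1`, `d₁` a unit, `T_t` induces a NON-SEMISIMPLE endomorphism of `L_ε/XL_ε`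
(`not_isSemisimple_mapQ`). Part B (`…SplitBitLink.lean`): link to p456967's index bit, invisibility of the bit
for `X` a unit, pairwise non-isomorphism of the `L_ε`. References: BSTW arXiv:2409.01350v2 I Props.
3.9/3.11/3.13; Betina–Dimitrov–Pozzi, Amer. J. Math. 144 (2022) (`𝔡_i = (X)`); bstw-MEMO-10 §4. Design:
THEOREMS ONLY (no def/structure/instance/notation/named fact).
-/

open Pointwise

-- lint debt, justified: the Theorems namespace repeats the summit name (D-0017); `dupNamespace` flags every decl.
set_option linter.dupNamespace false

namespace Summit.BirchSwinnertonDyer.BirchSwinnertonDyer.Theorems.SplitBit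

variable {R : Type*} [CommRing R]

/-! ## (i) The Hecke action on `L_ε` (bstw-MEMO-10 §4) -/

section Action

/-- The operator family `T^ε` on `L_ε = R³` exists: a Hecke element with eigenvalue triple `(a, a + X d₁, a + X d₂)`
acts by `(x₀,x₁,x₂) ↦ (a x₀ + ε₁d₁x₁ + ε₂d₂x₂, (a + X d₁)x₁, (a + X d₂)x₂)` (used only via `hT`). -/
theorem exists_family (X ε₁ ε₂ : R) :
    ∃ T : R → R → R → ((R × R × R) →ₗ[R] (R × R × R)), ∀ (a d₁ d₂ : R) (x : R × R × R), T a d₁ d₂ x =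
      (a * x.1 + ε₁ * d₁ * x.2.1 + ε₂ * d₂ * x.2.2, (a + X * d₁) * x.2.1, (a + X * d₂) * x.2.2) := by
  refine ⟨fun a d₁ d₂ =>
    { toFun := fun x => (a * x.1 + ε₁ * d₁ * x.2.1 + ε₂ * d₂ * x.2.2, (a + X * d₁) * x.2.1, (a + X * d₂) * x.2.2)
      map_add' := fun x y => by
        simp only [Prod.fst_add, Prod.snd_add, Prod.mk_add_mk, Prod.mk.injEq]
        exact ⟨by ring, by ring, by ring⟩
      map_smul' := fun r x => by
        simp only [Prod.smul_fst, Prod.smul_snd, smul_eq_mul, RingHom.id_apply, Prod.smul_mk, Prod.mk.injEq]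
        exact ⟨by ring, by ring, by ring⟩ }, fun a d₁ d₂ x => rfl⟩

/-- The diagonal family `Tb` on the cusp module `C = R²`, `(y₁,y₂) ↦ ((a + X d₁)y₁, (a + X d₂)y₂)`, exists. -/
theorem exists_quotFamily (X : R) :
    ∃ Tb : R → R → R → ((R × R) →ₗ[R] (R × R)), ∀ (a d₁ d₂ : R) (y : R × R),
      Tb a d₁ d₂ y = ((a + X * d₁) * y.1, (a + X * d₂) * y.2) := by
  refine ⟨fun a d₁ d₂ =>
    { toFun := fun y => ((a + X * d₁) * y.1, (a + X * d₂) * y.2)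
      map_add' := fun x y => by
        simp only [Prod.fst_add, Prod.snd_add, Prod.mk_add_mk, Prod.mk.injEq]
        exact ⟨by ring, by ring⟩
      map_smul' := fun r x => by
        simp only [Prod.smul_fst, Prod.smul_snd, smul_eq_mul, RingHom.id_apply, Prod.smul_mk, Prod.mk.injEq]
        exact ⟨by ring, by ring⟩ }, fun a d₁ d₂ y => rfl⟩

variable {X ε₁ ε₂ : R} (T : R → R → R → ((R × R × R) →ₗ[R] (R × R × R)))

/-- **Closure under composition = the fibre-product law** `T_t ∘ T_{t'} = T_{tt'}`: eigenvalue triples multiply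
coordinatewise, `(a+Xd_i)(a'+Xd_i') = aa' + X D_i` with `D_i = a d_i' + a' d_i + X d_i d_i'` — the `T_t` span an
action of the (commutative) completed Hecke algebra `𝓡 ⊆ {(λ₀,λ₁,λ₂) : λ_i ≡ λ₀ mod X}`. -/
theorem comp_eq
    (hT : ∀ (a d₁ d₂ : R) (x : R × R × R), T a d₁ d₂ x = (a * x.1 + ε₁ * d₁ * x.2.1 + ε₂ * d₂ * x.2.2,
      (a + X * d₁) * x.2.1, (a + X * d₂) * x.2.2))
    (a d₁ d₂ a' d₁' d₂' : R) :
    (T a d₁ d₂).comp (T a' d₁' d₂') =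
      T (a * a') (a * d₁' + a' * d₁ + X * d₁ * d₁') (a * d₂' + a' * d₂ + X * d₂ * d₂') := by
  apply LinearMap.ext
  intro x
  simp only [LinearMap.comp_apply, hT, Prod.mk.injEq]
  exact ⟨by ring, by ring, by ring⟩

/-- `T_t = λ₀(t)·id + T_{t₀}` with `t₀` the "nilpotent part" triple `(0, d₁, d₂)`, pointwise. -/
theorem apply_eq_smul_add
    (hT : ∀ (a d₁ d₂ : R) (x : R × R × R), T a d₁ d₂ x = (a * x.1 + ε₁ * d₁ * x.2.1 + ε₂ * d₂ * x.2.2,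
      (a + X * d₁) * x.2.1, (a + X * d₂) * x.2.2))
    (a d₁ d₂ : R) (x : R × R × R) : T a d₁ d₂ x = a • x + T 0 d₁ d₂ x := by
  rw [hT, hT]
  obtain ⟨x₀, x₁, x₂⟩ := x
  simp only [Prod.smul_mk, smul_eq_mul, Prod.mk_add_mk, Prod.mk.injEq]
  exact ⟨by ring, by ring, by ring⟩

/-- **`h` is a common eigenvector**, `T_t h = λ₀(t) h`: the cuspidal line `H⁻ ⊂ 𝓗⁻` is an `𝓡`-submodule. -/
theorem apply_h
    (hT : ∀ (a d₁ d₂ : R) (x : R × R × R), T a d₁ d₂ x = (a * x.1 + ε₁ * d₁ * x.2.1 + ε₂ * d₂ * x.2.2,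
      (a + X * d₁) * x.2.1, (a + X * d₂) * x.2.2))
    (a d₁ d₂ : R) : T a d₁ d₂ (1, 0, 0) = a • ((1, 0, 0) : R × R × R) := by
  rw [hT]
  simp

/-- **The cusp module carries the diagonal action**: the projection `L_ε → C = L_ε/Rh` (second and third
coordinates) intertwines `T_t` with `Tb_t = diag(λ₁(t), λ₂(t))` (bstw-MEMO-10 (m1)). -/
theorem snd_comp
    (hT : ∀ (a d₁ d₂ : R) (x : R × R × R), T a d₁ d₂ x = (a * x.1 + ε₁ * d₁ * x.2.1 + ε₂ * d₂ * x.2.2,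
      (a + X * d₁) * x.2.1, (a + X * d₂) * x.2.2))
    (Tb : R → R → R → ((R × R) →ₗ[R] (R × R)))
    (hTb : ∀ (a d₁ d₂ : R) (y : R × R), Tb a d₁ d₂ y = ((a + X * d₁) * y.1, (a + X * d₂) * y.2))
    (a d₁ d₂ : R) :
    (LinearMap.snd R R (R × R)).comp (T a d₁ d₂) = (Tb a d₁ d₂).comp (LinearMap.snd R R (R × R)) := by
  apply LinearMap.ext
  intro x
  simp only [LinearMap.comp_apply, LinearMap.snd_apply, hT, hTb]

end Action

/-! ## (ii) (♭′-1): the extension `0 → Rh → L_ε → C → 0` splits `T`-equivariantly iff `ε = (0,0)` -/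

section Splitting

variable {X ε₁ ε₂ : R} (T : R → R → R → ((R × R × R) →ₗ[R] (R × R × R)))
  (Tb : R → R → R → ((R × R) →ₗ[R] (R × R)))

/-- **`ε = (0,0)` ⇒ SPLIT.** The inclusion `C = R² ↪ R³`, `y ↦ (0, y)` is a `T`-equivariant section of the
projection (`L_(0,0) = Rh ⊕ (Re₁ ⊕ Re₂)` as `𝓡`-modules). -/
theorem exists_equivariant_section
    (hT : ∀ (a d₁ d₂ : R) (x : R × R × R), T a d₁ d₂ x = (a * x.1 + ε₁ * d₁ * x.2.1 + ε₂ * d₂ * x.2.2,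
      (a + X * d₁) * x.2.1, (a + X * d₂) * x.2.2))
    (hTb : ∀ (a d₁ d₂ : R) (y : R × R), Tb a d₁ d₂ y = ((a + X * d₁) * y.1, (a + X * d₂) * y.2))
    (hε : ε₁ = 0 ∧ ε₂ = 0) :
    ∃ s : (R × R) →ₗ[R] (R × R × R), (LinearMap.snd R R (R × R)).comp s = LinearMap.id ∧
      ∀ a d₁ d₂ : R, (T a d₁ d₂).comp s = s.comp (Tb a d₁ d₂) := by
  obtain ⟨rfl, rfl⟩ := hε
  refine ⟨LinearMap.inr R R (R × R), LinearMap.ext fun _ => rfl, fun a d₁ d₂ => ?_⟩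
  apply LinearMap.ext
  intro y
  simp only [LinearMap.comp_apply, LinearMap.inr_apply, hT, hTb]
  simp

/-- A section `s` of the projection has the shape `s (1,0) = (σ₁, 1, 0)`, `s (0,1) = (σ₂, 0, 1)`. -/
theorem exists_apply_eq_of_section {s : (R × R) →ₗ[R] (R × R × R)}
    (hs : (LinearMap.snd R R (R × R)).comp s = LinearMap.id) :
    (∃ σ₁ : R, s (1, 0) = (σ₁, 1, 0)) ∧ (∃ σ₂ : R, s (0, 1) = (σ₂, 0, 1)) := by
  have h2 : ∀ y : R × R, (s y).2 = y := fun y => by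
    simpa using LinearMap.congr_fun hs y
  exact ⟨⟨(s (1, 0)).1, Prod.ext rfl (h2 _)⟩, ⟨(s (0, 1)).1, Prod.ext rfl (h2 _)⟩⟩

/-- Equivariance for ONE Hecke element on `ẽ₁`'s lift forces the `h`-coordinate relation `ε₁ d₁ = X d₁ σ₁`. -/
theorem eps₁_mul_eq_of_comm
    (hT : ∀ (a d₁ d₂ : R) (x : R × R × R), T a d₁ d₂ x = (a * x.1 + ε₁ * d₁ * x.2.1 + ε₂ * d₂ * x.2.2,
      (a + X * d₁) * x.2.1, (a + X * d₂) * x.2.2))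
    (hTb : ∀ (a d₁ d₂ : R) (y : R × R), Tb a d₁ d₂ y = ((a + X * d₁) * y.1, (a + X * d₂) * y.2))
    {s : (R × R) →ₗ[R] (R × R × R)} {σ₁ : R} (hs1 : s (1, 0) = (σ₁, 1, 0)) {a d₁ d₂ : R}
    (hcomm : (T a d₁ d₂).comp s = s.comp (Tb a d₁ d₂)) : ε₁ * d₁ = X * d₁ * σ₁ := by
  have hTb1 : Tb a d₁ d₂ (1, 0) = (a + X * d₁) • ((1, 0) : R × R) := by
    rw [hTb]; simp
  have e1 := congrArg Prod.fst (LinearMap.congr_fun hcomm (1, 0))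
  rw [LinearMap.comp_apply, LinearMap.comp_apply, hTb1, map_smul, hs1, hT] at e1
  simp only [Prod.smul_mk, smul_eq_mul] at e1
  linear_combination e1

/-- The same relation on `ẽ₂`'s lift: `ε₂ d₂ = X d₂ σ₂`. -/
theorem eps₂_mul_eq_of_comm
    (hT : ∀ (a d₁ d₂ : R) (x : R × R × R), T a d₁ d₂ x = (a * x.1 + ε₁ * d₁ * x.2.1 + ε₂ * d₂ * x.2.2,
      (a + X * d₁) * x.2.1, (a + X * d₂) * x.2.2))
    (hTb : ∀ (a d₁ d₂ : R) (y : R × R), Tb a d₁ d₂ y = ((a + X * d₁) * y.1, (a + X * d₂) * y.2))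
    {s : (R × R) →ₗ[R] (R × R × R)} {σ₂ : R} (hs2 : s (0, 1) = (σ₂, 0, 1)) {a d₁ d₂ : R}
    (hcomm : (T a d₁ d₂).comp s = s.comp (Tb a d₁ d₂)) : ε₂ * d₂ = X * d₂ * σ₂ := by
  have hTb2 : Tb a d₁ d₂ (0, 1) = (a + X * d₂) • ((0, 1) : R × R) := by
    rw [hTb]; simp
  have e2 := congrArg Prod.fst (LinearMap.congr_fun hcomm (0, 1))
  rw [LinearMap.comp_apply, LinearMap.comp_apply, hTb2, map_smul, hs2, hT] at e2
  simp only [Prod.smul_mk, smul_eq_mul] at e2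
  linear_combination e2

/-- **Robust (m3) form, first cusp line.** If `X` is a non-unit, `ε₁ ∈ {0,1}`, and some section is
equivariant for ONE Hecke element whose `d₁ = (λ₁ − λ₀)(t)/X` is a unit, then `ε₁ = 0`. -/
theorem eps₁_eq_zero_of_comm
    (hT : ∀ (a d₁ d₂ : R) (x : R × R × R), T a d₁ d₂ x = (a * x.1 + ε₁ * d₁ * x.2.1 + ε₂ * d₂ * x.2.2,
      (a + X * d₁) * x.2.1, (a + X * d₂) * x.2.2))
    (hTb : ∀ (a d₁ d₂ : R) (y : R × R), Tb a d₁ d₂ y = ((a + X * d₁) * y.1, (a + X * d₂) * y.2))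
    (hXu : ¬ IsUnit X) (he₁ : ε₁ = 0 ∨ ε₁ = 1) {s : (R × R) →ₗ[R] (R × R × R)}
    (hs : (LinearMap.snd R R (R × R)).comp s = LinearMap.id) {a d₁ d₂ : R} (hd₁ : IsUnit d₁)
    (hcomm : (T a d₁ d₂).comp s = s.comp (Tb a d₁ d₂)) : ε₁ = 0 := by
  obtain ⟨⟨σ₁, hs1⟩, -⟩ := exists_apply_eq_of_section hs
  have h1 := eps₁_mul_eq_of_comm T Tb hT hTb hs1 hcomm
  refine he₁.resolve_right fun h => hXu ?_
  obtain ⟨u, hu⟩ := hd₁.exists_left_inv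
  rw [h, one_mul] at h1
  exact isUnit_iff_exists_inv.2 ⟨σ₁ * d₁ * u, by linear_combination hu - u * h1⟩

/-- **Robust (m3) form, second cusp line**: likewise `ε₂ = 0` from one element with `d₂` a unit. -/
theorem eps₂_eq_zero_of_comm
    (hT : ∀ (a d₁ d₂ : R) (x : R × R × R), T a d₁ d₂ x = (a * x.1 + ε₁ * d₁ * x.2.1 + ε₂ * d₂ * x.2.2,
      (a + X * d₁) * x.2.1, (a + X * d₂) * x.2.2))
    (hTb : ∀ (a d₁ d₂ : R) (y : R × R), Tb a d₁ d₂ y = ((a + X * d₁) * y.1, (a + X * d₂) * y.2))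
    (hXu : ¬ IsUnit X) (he₂ : ε₂ = 0 ∨ ε₂ = 1) {s : (R × R) →ₗ[R] (R × R × R)}
    (hs : (LinearMap.snd R R (R × R)).comp s = LinearMap.id) {a d₁ d₂ : R} (hd₂ : IsUnit d₂)
    (hcomm : (T a d₁ d₂).comp s = s.comp (Tb a d₁ d₂)) : ε₂ = 0 := by
  obtain ⟨-, ⟨σ₂, hs2⟩⟩ := exists_apply_eq_of_section hs
  have h2 := eps₂_mul_eq_of_comm T Tb hT hTb hs2 hcomm
  refine he₂.resolve_right fun h => hXu ?_
  obtain ⟨u, hu⟩ := hd₂.exists_left_inv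
  rw [h, one_mul] at h2
  exact isUnit_iff_exists_inv.2 ⟨σ₂ * d₂ * u, by linear_combination hu - u * h2⟩

/-- **(♭′-1), kernel form.** For `X` a non-unit and `ε_i ∈ {0,1}`: the extension `0 → Rh → L_ε → C → 0`
admits an `R`-linear section equivariant for the whole family `T` IFF `ε = (0,0)` (bstw-MEMO-10 (C4):
"the exact sequence `0 → H⁻ → 𝓗⁻ → C_{Q₀} → 0` does not split [as `𝓡`-modules]" ⟺ `ε ≠ (0,0)`). -/
theorem exists_equivariant_section_iff
    (hT : ∀ (a d₁ d₂ : R) (x : R × R × R), T a d₁ d₂ x = (a * x.1 + ε₁ * d₁ * x.2.1 + ε₂ * d₂ * x.2.2,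
      (a + X * d₁) * x.2.1, (a + X * d₂) * x.2.2))
    (hTb : ∀ (a d₁ d₂ : R) (y : R × R), Tb a d₁ d₂ y = ((a + X * d₁) * y.1, (a + X * d₂) * y.2))
    (hXu : ¬ IsUnit X) (he₁ : ε₁ = 0 ∨ ε₁ = 1) (he₂ : ε₂ = 0 ∨ ε₂ = 1) :
    (∃ s : (R × R) →ₗ[R] (R × R × R), (LinearMap.snd R R (R × R)).comp s = LinearMap.id ∧
      ∀ a d₁ d₂ : R, (T a d₁ d₂).comp s = s.comp (Tb a d₁ d₂)) ↔ (ε₁ = 0 ∧ ε₂ = 0) := by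
  constructor
  · rintro ⟨s, hs, hcomm⟩
    exact ⟨eps₁_eq_zero_of_comm T Tb hT hTb hXu he₁ hs isUnit_one (hcomm 0 1 0),
      eps₂_eq_zero_of_comm T Tb hT hTb hXu he₂ hs isUnit_one (hcomm 0 0 1)⟩
  · exact exists_equivariant_section T Tb hT hTb

end Splitting

/-! ## (iii) (♭′-3): the action on `L_ε / X L_ε` is scalar iff `ε = (0,0)`; otherwise non-semisimple -/

section ModX

variable {X ε₁ ε₂ : R} (T : R → R → R → ((R × R × R) →ₗ[R] (R × R × R)))

/-- **`ε = (0,0)` ⇒ SCALAR mod `X`.** `T_t x − λ₀(t) x ∈ X L` for every `t` and `x`: the weight-one Hecke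
algebra `𝓡/X` acts on `L_(0,0)/XL_(0,0)` through the single character `λ̄`. -/
theorem sub_smul_mem_of_eq_zero
    (hT : ∀ (a d₁ d₂ : R) (x : R × R × R), T a d₁ d₂ x = (a * x.1 + ε₁ * d₁ * x.2.1 + ε₂ * d₂ * x.2.2,
      (a + X * d₁) * x.2.1, (a + X * d₂) * x.2.2))
    (hε : ε₁ = 0 ∧ ε₂ = 0) (a d₁ d₂ : R) (x : R × R × R) :
    T a d₁ d₂ x - a • x ∈ X • (⊤ : Submodule R (R × R × R)) := by
  obtain ⟨rfl, rfl⟩ := hε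
  rw [Submodule.mem_smul_pointwise_iff_exists]
  refine ⟨(0, d₁ * x.2.1, d₂ * x.2.2), Submodule.mem_top, ?_⟩
  rw [hT]
  obtain ⟨x₀, x₁, x₂⟩ := x
  simp only [Prod.smul_mk, smul_eq_mul, Prod.mk_sub_mk, Prod.mk.injEq]
  exact ⟨by ring, by ring, by ring⟩

/-- `(T_t − λ₀(t)) ẽ₁ = (ε₁ d₁, X d₁, 0)` (= `ε₁ d₁ h + X d₁ ẽ₁`). -/
theorem apply_e₁_sub_smul
    (hT : ∀ (a d₁ d₂ : R) (x : R × R × R), T a d₁ d₂ x = (a * x.1 + ε₁ * d₁ * x.2.1 + ε₂ * d₂ * x.2.2,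
      (a + X * d₁) * x.2.1, (a + X * d₂) * x.2.2))
    (a d₁ d₂ : R) :
    T a d₁ d₂ (0, 1, 0) - a • ((0, 1, 0) : R × R × R) = (ε₁ * d₁, X * d₁, 0) := by
  rw [hT]
  simp only [Prod.smul_mk, smul_eq_mul, Prod.mk_sub_mk, Prod.mk.injEq]
  exact ⟨by ring, by ring, by ring⟩

/-- `(T_t − λ₀(t)) ẽ₂ = (ε₂ d₂, 0, X d₂)`. -/
theorem apply_e₂_sub_smul
    (hT : ∀ (a d₁ d₂ : R) (x : R × R × R), T a d₁ d₂ x = (a * x.1 + ε₁ * d₁ * x.2.1 + ε₂ * d₂ * x.2.2,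
      (a + X * d₁) * x.2.1, (a + X * d₂) * x.2.2))
    (a d₁ d₂ : R) :
    T a d₁ d₂ (0, 0, 1) - a • ((0, 0, 1) : R × R × R) = (ε₂ * d₂, 0, X * d₂) := by
  rw [hT]
  simp only [Prod.smul_mk, smul_eq_mul, Prod.mk_sub_mk, Prod.mk.injEq]
  exact ⟨by ring, by ring, by ring⟩

/-- The first coordinate of an element of `X • R³` is a multiple of `X`. -/
theorem exists_fst_eq_of_mem_smul_top {v : R × R × R}
    (hv : v ∈ X • (⊤ : Submodule R (R × R × R))) : ∃ c : R, v.1 = c * X := by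
  obtain ⟨y, -, rfl⟩ := (Submodule.mem_smul_pointwise_iff_exists _ _ _).1 hv
  exact ⟨y.1, by simp [mul_comm]⟩

/-- **`ε₁ = 1`, `d₁` a unit, `X` a non-unit ⇒ NOT scalar mod `X`**: `(T_t − λ₀(t)) ẽ₁ ∉ X L`
(its `h`-coordinate `ε₁ d₁` is a unit). -/
theorem not_sub_smul_mem₁
    (hT : ∀ (a d₁ d₂ : R) (x : R × R × R), T a d₁ d₂ x = (a * x.1 + ε₁ * d₁ * x.2.1 + ε₂ * d₂ * x.2.2,
      (a + X * d₁) * x.2.1, (a + X * d₂) * x.2.2))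
    (hXu : ¬ IsUnit X) (he : ε₁ = 1) {d₁ : R} (hd₁ : IsUnit d₁) (a d₂ : R) :
    T a d₁ d₂ (0, 1, 0) - a • ((0, 1, 0) : R × R × R) ∉ X • (⊤ : Submodule R (R × R × R)) := by
  intro hmem
  rw [apply_e₁_sub_smul T hT] at hmem
  obtain ⟨c, hc⟩ := exists_fst_eq_of_mem_smul_top hmem
  simp only [he, one_mul] at hc
  rw [hc] at hd₁
  exact hXu (isUnit_of_mul_isUnit_right hd₁)

/-- The same for the second cusp line: `ε₂ = 1`, `d₂` a unit ⇒ `(T_t − λ₀(t)) ẽ₂ ∉ X L`. -/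
theorem not_sub_smul_mem₂
    (hT : ∀ (a d₁ d₂ : R) (x : R × R × R), T a d₁ d₂ x = (a * x.1 + ε₁ * d₁ * x.2.1 + ε₂ * d₂ * x.2.2,
      (a + X * d₁) * x.2.1, (a + X * d₂) * x.2.2))
    (hXu : ¬ IsUnit X) (he : ε₂ = 1) {d₂ : R} (hd₂ : IsUnit d₂) (a d₁ : R) :
    T a d₁ d₂ (0, 0, 1) - a • ((0, 0, 1) : R × R × R) ∉ X • (⊤ : Submodule R (R × R × R)) := by
  intro hmem
  rw [apply_e₂_sub_smul T hT] at hmem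
  obtain ⟨c, hc⟩ := exists_fst_eq_of_mem_smul_top hmem
  simp only [he, one_mul] at hc
  rw [hc] at hd₂
  exact hXu (isUnit_of_mul_isUnit_right hd₂)

/-- **(♭′-3), kernel form (scalar ⟺ `ε = (0,0)`).** For `X` a non-unit and `ε_i ∈ {0,1}`: EVERY Hecke
element acts on `L_ε/XL_ε` as the scalar `λ̄(t)` IFF `ε = (0,0)`. The three characters `λ_{𝐡_v}, λ_{𝐄₁},
λ_{𝐄₂}` coincide mod `X` (all specialise to `E₁(1,χ_L)^{(p)}`), so "scalar" is exactly "semisimple" for the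
commutative algebra `𝓡/X` here (bstw-MEMO-10 (♭′-3): "for `ε = (0,0)` the action is scalar"). -/
theorem forall_sub_smul_mem_iff
    (hT : ∀ (a d₁ d₂ : R) (x : R × R × R), T a d₁ d₂ x = (a * x.1 + ε₁ * d₁ * x.2.1 + ε₂ * d₂ * x.2.2,
      (a + X * d₁) * x.2.1, (a + X * d₂) * x.2.2))
    (hXu : ¬ IsUnit X) (he₁ : ε₁ = 0 ∨ ε₁ = 1) (he₂ : ε₂ = 0 ∨ ε₂ = 1) :
    (∀ (a d₁ d₂ : R) (x : R × R × R), T a d₁ d₂ x - a • x ∈ X • (⊤ : Submodule R (R × R × R))) ↔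
      (ε₁ = 0 ∧ ε₂ = 0) :=
  ⟨fun h => ⟨he₁.resolve_right fun h₁ => not_sub_smul_mem₁ T hT hXu h₁ isUnit_one 0 0 (h 0 1 0 _),
      he₂.resolve_right fun h₂ => not_sub_smul_mem₂ T hT hXu h₂ isUnit_one 0 0 (h 0 0 1 _)⟩,
    fun hε a d₁ d₂ x => sub_smul_mem_of_eq_zero T hT hε a d₁ d₂ x⟩

/-- Every `R`-linear endomorphism preserves `X L` (so it descends to `L/XL`). -/
theorem smul_top_le_comap (f : (R × R × R) →ₗ[R] (R × R × R)) :
    X • (⊤ : Submodule R (R × R × R)) ≤ (X • (⊤ : Submodule R (R × R × R))).comap f := by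
  intro v hv
  obtain ⟨y, -, rfl⟩ := (Submodule.mem_smul_pointwise_iff_exists _ _ _).1 hv
  rw [Submodule.mem_comap, map_smul]
  exact Submodule.smul_mem_pointwise_smul _ X ⊤ Submodule.mem_top

/-- The nilpotent parts square into `X L`: `T_{(0,d₁,d₂)} (T_{(0,d₁',d₂')} x) = X • T_{(0, d₁d₁', d₂d₂')} x`. -/
theorem apply_zero_apply_zero
    (hT : ∀ (a d₁ d₂ : R) (x : R × R × R), T a d₁ d₂ x = (a * x.1 + ε₁ * d₁ * x.2.1 + ε₂ * d₂ * x.2.2,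
      (a + X * d₁) * x.2.1, (a + X * d₂) * x.2.2))
    (d₁ d₂ d₁' d₂' : R) (x : R × R × R) :
    T 0 d₁ d₂ (T 0 d₁' d₂' x) = X • T 0 (d₁ * d₁') (d₂ * d₂') x := by
  simp only [hT, Prod.smul_mk, smul_eq_mul, Prod.mk.injEq]
  exact ⟨by ring, by ring, by ring⟩

/-- **(♭′-3), kernel form (NON-SEMISIMPLE).** For `X` a non-unit, `ε₁ = 1` and a Hecke element `t` with
`d₁` a unit, the endomorphism of `L_ε/XL_ε` induced by `T_t` is NOT semisimple: `T_t − λ₀(t)` induces a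
NON-ZERO nilpotent of square zero (`Module.End.eq_zero_of_isNilpotent_isSemisimple`). This is bstw-MEMO-10
(♭′-3): "`t` acts by `λ̄(t)·id + N(t)` with `N(t)ẽ_i = ((λ_{𝐄_i} − λ_{𝐡_v})(t)/X mod X)·h ≠ 0` for suitable
`t`". (The hypothesis `hle` is always available: `smul_top_le_comap`.) -/
theorem not_isSemisimple_mapQ
    (hT : ∀ (a d₁ d₂ : R) (x : R × R × R), T a d₁ d₂ x = (a * x.1 + ε₁ * d₁ * x.2.1 + ε₂ * d₂ * x.2.2,
      (a + X * d₁) * x.2.1, (a + X * d₂) * x.2.2))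
    (hXu : ¬ IsUnit X) (he : ε₁ = 1) {d₁ : R} (hd₁ : IsUnit d₁) (a d₂ : R)
    (hle : X • (⊤ : Submodule R (R × R × R)) ≤ (X • (⊤ : Submodule R (R × R × R))).comap (T a d₁ d₂)) :
    ¬ Module.End.IsSemisimple ((X • (⊤ : Submodule R (R × R × R))).mapQ (X • ⊤) (T a d₁ d₂) hle) := by
  intro hss
  have hleN : X • (⊤ : Submodule R (R × R × R)) ≤
      (X • (⊤ : Submodule R (R × R × R))).comap (T 0 d₁ d₂) := smul_top_le_comap (T 0 d₁ d₂)
  -- the induced nilpotent part `N̄` = reduction of `T_t − λ₀(t)`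
  have hsub : (X • (⊤ : Submodule R (R × R × R))).mapQ (X • ⊤) (T a d₁ d₂) hle -
      algebraMap R (Module.End R ((R × R × R) ⧸ (X • (⊤ : Submodule R (R × R × R))))) a =
      (X • (⊤ : Submodule R (R × R × R))).mapQ (X • ⊤) (T 0 d₁ d₂) hleN := by
    apply LinearMap.ext
    intro q
    obtain ⟨x, rfl⟩ := Submodule.Quotient.mk_surjective _ q
    rw [LinearMap.sub_apply, Submodule.mapQ_apply, Submodule.mapQ_apply, Module.algebraMap_end_apply,
      apply_eq_smul_add T hT a d₁ d₂ x, Submodule.Quotient.mk_add, Submodule.Quotient.mk_smul,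
      add_sub_cancel_left]
  have hN : Module.End.IsSemisimple
      ((X • (⊤ : Submodule R (R × R × R))).mapQ (X • ⊤) (T 0 d₁ d₂) hleN) := by
    rw [← hsub]
    exact Module.End.isSemisimple_sub_algebraMap_iff.2 hss
  have hnil : IsNilpotent ((X • (⊤ : Submodule R (R × R × R))).mapQ (X • ⊤) (T 0 d₁ d₂) hleN) := by
    refine ⟨2, ?_⟩
    rw [pow_two]
    apply LinearMap.ext
    intro q
    obtain ⟨x, rfl⟩ := Submodule.Quotient.mk_surjective _ q
    rw [Module.End.mul_apply, Submodule.mapQ_apply, Submodule.mapQ_apply, LinearMap.zero_apply,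
      apply_zero_apply_zero T hT, Submodule.Quotient.mk_eq_zero]
    exact Submodule.smul_mem_pointwise_smul _ X ⊤ Submodule.mem_top
  have h0 := Module.End.eq_zero_of_isNilpotent_isSemisimple hnil hN
  have h1 := LinearMap.congr_fun h0 (Submodule.Quotient.mk (0, 1, 0))
  rw [Submodule.mapQ_apply, LinearMap.zero_apply, Submodule.Quotient.mk_eq_zero] at h1
  apply not_sub_smul_mem₁ T hT hXu he hd₁ 0 d₂
  rwa [zero_smul, sub_zero]

end ModX

end Summit.BirchSwinnertonDyer.BirchSwinnertonDyer.Theorems.SplitBit
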